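/-
Copyright: the b2b-balaban T⁴-continuum CRUX team, row NE7b OWNER lineage `t4-ne7b-p1` (gen 108). Project licence.
-/
import Summits.QuantumFields.BalabanUV.T4Continuum.Spine.NE7b.ConvexWindowTiltRecentred

/-!
# THE WINDOWED EXPONENT SHIFT UNDER A ONE-SIDED QUADRATIC GROWTH LETTER: `W ≤ a + b‖· − x₀‖²` ON `K` ⟹
# `∫_K e^{−V} ≤ exp(a + b·n∕λ)·∫_K e^{−(V+W)}` (centre carrying the variational letter) and, with NO centre letter (any `x₀ ∈ K`),
# `∫_K e^{−V} ≤ exp(a + b·(‖∇V x₀‖∕λ + √(n∕λ))²)·∫_K e^{−(V+W)}`; `LocCondStability` BY NAME with `b = a + b·(G₀∕λ + √(n∕λ))²`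
# (row NE7b, node U5c; residual (R2′) family (2) — the RATIO step for a GENERAL exponent difference, refuter F464's «growth letter»)

Cell `pub-balaban`, sub-cell `t4`, spine estimate NE7b (`T4WeightBudget.RelWeightBound`; the cell's OWN estimate — NOT PRINTED in
[Bałaban 1983–89], NOT PROVED).  Crux-route work under `Spine/NE7b/` by the row's OWNER; NOTHING of Bałaban's is named or asserted;
no `T4Continuum/Support` leaf typed; no `def`; zero `sorry`.

WHY.  The windowed convexity road (`…ConvexWindowTiltMoment` → `…ConvexWindowTiltRecentred`) compares `∫_K e^{−V}` with
`∫_K e^{−(V+g)}` for a SACRIFICED QUADRATIC FORM `g = Σ_k q_k⟪u_k,·⟫²` (Brascamp–Lieb for the variances, the virial inequality for the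
means).  The R-step's ratio has a GENERAL exponent difference `W = V₁ − V₀` (refuter F464: «the second moments of one windowed measure
bound such a ratio only through the tilt … plus a growth letter `|V₁ − V₀|(y) ≤ A + B‖y − x₀‖²` on `K`»).  ONE Jensen step under the
NUMERATOR's windowed tilt does it, one-sidedly and without Brascamp–Lieb: `∫_K e^{−V} ∕ ∫_K e^{−(V+W)} = 1 ∕ ⟨e^{−W}⟩_{ν_{V,K}} ≤
exp⟨W⟩_{ν_{V,K}}`, and `⟨W⟩ ≤ a + b⟨‖y − x₀‖²⟩ ≤ a + b·n∕λ` by the windowed virial inequality about a centre carrying the variational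
letter (`…ConvexWindowVirial` §5); WITHOUT any centre letter, leaf-01's `hcrit`-free
`…ConvexWindowMinimiserTilted.sqrt_integral_norm_sub_sq_windowTilted_le_of_gradient` gives `√⟨‖y − x₀‖²⟩ ≤ ‖∇V x₀‖∕λ + √(n∕λ)` about ANY
`x₀ ∈ K` (the two first-order letters at `(x₀, y)`, `(y, x₀)` and the virial inequality; no compactness), so `⟨W⟩ ≤ a + b(‖∇V x₀‖∕λ + √(n∕λ))²`.
For `W = g` with orthonormal `u` this REFINES `…ConvexWindowTiltCentred` §3 (`b = q_max`, `a = 0`: budget `q_max·n∕λ` instead of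
`(Σ_k q_k + n·q_max)∕λ`, by pointwise Bessel).

WHAT IS PROVED ([folklore]; the owner's Jensen step `…ConvexTiltMoment.integral_mul_exp_le_exp_tiltedMean` and leaf-01's
`…ConvexWindowMinimiserTilted.sqrt_integral_norm_sub_sq_windowTilted_le_of_gradient` BY NAME):
* §1 **`setIntegral_exp_neg_le_exp_windowTiltedMean_mul`**: `K` bounded, `V`, `W` continuous ⟹
  `∫_K e^{−V} ≤ exp(∫ W dν_{V,K})·∫_K e^{−(V+W)}` (volume-zero window allowed).
* §2 `integral_norm_sub_sq_windowTilted_le` (`∫‖y − x₀‖² dν_{V,K} ≤ n∕λ` about a centre carrying the variational letter),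
  **`windowTiltedMean_le_of_growth`** (`W ≤ a + b‖· − x₀‖²` on `K`, `b ≥ 0`, `x₀ ∈ K` carrying the variational letter ⟹
  `∫ W dν_{V,K} ≤ a + b·n∕λ`), **`windowTiltedMean_le_of_growth_of_gradient`** (NO centre letter, any `x₀ ∈ K`:
  `∫ W dν_{V,K} ≤ a + b·(‖∇V x₀‖∕λ + √(n∕λ))²`).
* §3 the ENDs **`exp_shift_le_of_growth_on_boundedConvexWindow`** (`∫_K e^{−V} ≤ exp(a + b·n∕λ)·∫_K e^{−(V+W)}`) and
  **`exp_shift_le_of_growth_on_boundedConvexWindow_of_gradient`** (NO centre letter: `exp(a + b·(‖∇V x₀‖∕λ + √(n∕λ))²)`),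
  `exponentShiftCarrier_le` (`‖∇V x₀‖ ≤ G₀`).
* §4 the junction BY NAME **`locCondStability_of_exponentShiftCarrier_on_support`**: per `(j, g, y)` the window `Kw`, the exponents
  `V`, `W` and the nominal centre `x₀` (background-dependent allowed); ON THE SUPPORT: `Kw` convex bounded measurable with `x₀ ∈ Kw`,
  `V ∈ C¹` `lam j g`-convex ON `Kw` with `‖∇V x₀‖ ≤ G₀ j g`, `W` continuous with `W ≤ a j g + b j g‖· − x₀‖²` on `Kw` — the numbers
  `lam, a, b, G₀` y-UNIFORM, the fibre dimension `n j g` ⟹ `LocCondStability T S K μ ρ₀ M (a + b·(G₀∕lam + √(n∕lam))²)` — THE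
  family-(2) socket for a GENERAL one-step exponent difference.

NOT HERE (honest): the growth letter's numbers by value and which exponents print's R-operation compares ((A1c)∕(A3) readings; the
corridor letter for `G₀`, refuter κ-ne7bref-g73-1 — `…ConvexWindowTiltRecentred` §1 turns a bound on the linear term over an inscribed
ball into `G₀`); the modulus `lam` by value (BILL item 1; `…ConvexWindowLocalSocket` ∕ `…HessianLocality` supply it in kind from
per-plaquette constants); anything of Bałaban's.  NE7b NOT PRINTED ∕ NOT PROVED; spine PROVED 0∕9; rung (B)+1 on a FINITE
torus — NOT infinite volume, NOT the mass gap, NOT Clay.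
HONEST DEPENDENCY: continuum YM on T⁴ ⇐ BetaPertH ∧ nine spine estimates (0/9 proved); BetaPertH ⇐ (D1) ∧ (D4) ∧ CAP+tail.
-/

set_option autoImplicit false

noncomputable section

open MeasureTheory Real Finset
open scoped RealInnerProductSpace
open Summit.QuantumFields.BalabanUV.T4Continuum.B16HistoryIndexedRepr Summit.QuantumFields.BalabanUV.T4Continuum.B16HistoryReprChain
open Summit.QuantumFields.BalabanUV.T4Continuum.NE7b.PrefixExtraction Summit.QuantumFields.BalabanUV.T4Continuum.NE7b.LocalConditionalStability
open Summit.QuantumFields.BalabanUV.T4Continuum.NE7b.CarrierOnSupport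
open Summit.QuantumFields.BalabanUV.T4Continuum.NE7b.ConvexTiltMoment
open Summit.QuantumFields.BalabanUV.T4Continuum.NE7b.ConvexWindowTiltMoment
open Summit.QuantumFields.BalabanUV.T4Continuum.NE7b.ConvexWindowVirial
open Summit.QuantumFields.BalabanUV.T4Continuum.NE7b.ConvexWindowTiltCentred
open Summit.QuantumFields.BalabanUV.T4Continuum.NE7b.ConvexWindowTiltRecentred
open Summit.QuantumFields.BalabanUV.T4Continuum.NE7b.ConvexWindowMinimiserTilted

namespace Summit.QuantumFields.BalabanUV.T4Continuum.NE7b.ConvexWindowExponentShift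

variable {n : ℕ}

/-! ## §1 One Jensen step under the numerator's windowed tilt -/

/-- **THE WINDOWED EXPONENT SHIFT BY ONE JENSEN STEP.**  `K` bounded, `V` and `W` continuous:
`∫_K e^{−V} ≤ exp(∫ W dν_{V,K}) · ∫_K e^{−(V+W)}`, `ν_{V,K} = 1_K e^{−V}dx ∕ ∫_K e^{−V}` — since `∫_K e^{−(V+W)} = (∫_K e^{−V})·⟨e^{−W}⟩_ν
≥ (∫_K e^{−V})·e^{−⟨W⟩_ν}`.  One-sided in `W`, no convexity; a window of volume zero is allowed. [folklore] -/
theorem setIntegral_exp_neg_le_exp_windowTiltedMean_mul {V W : EuclideanSpace ℝ (Fin n) → ℝ}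
    {K : Set (EuclideanSpace ℝ (Fin n))} (hKb : Bornology.IsBounded K) (hVc : Continuous V) (hWc : Continuous W) :
    ∫ x in K, exp (-V x) ≤
      exp (∫ x, W x ∂((volume.restrict K).tilted fun x => -V x)) * ∫ x in K, exp (-(V x + W x)) := by
  by_cases hK0 : volume K = 0
  · have h0 : (volume.restrict K : Measure (EuclideanSpace ℝ (Fin n))) = 0 := Measure.restrict_eq_zero.2 hK0
    rw [h0, integral_zero_measure, integral_zero_measure, mul_zero]
  haveI : NeZero (volume.restrict K : Measure (EuclideanSpace ℝ (Fin n))) :=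
    ⟨fun h => hK0 (Measure.restrict_eq_zero.1 h)⟩
  have hZ : IntegrableOn (fun x => exp (-V x)) K := integrableOn_exp_neg_of_isBounded hKb hVc
  have eρ : ∀ x : EuclideanSpace ℝ (Fin n), exp (-(V x + W x)) * exp (W x) = exp (-V x) := fun x => by
    rw [← exp_add]; ring_nf
  have hρi : IntegrableOn (fun x : EuclideanSpace ℝ (Fin n) => exp (-(V x + W x))) K :=
    integrableOn_exp_neg_of_isBounded hKb (hVc.add hWc)
  have hZ' : Integrable (fun x : EuclideanSpace ℝ (Fin n) => exp (-(V x + W x)) * exp (W x)) (volume.restrict K) := by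
    simp_rw [eρ]; exact hZ
  have hgi : Integrable (fun x : EuclideanSpace ℝ (Fin n) => W x * (exp (-(V x + W x)) * exp (W x))) (volume.restrict K) := by
    simp_rw [eρ]
    exact ((hWc.mul hVc.neg.rexp).continuousOn.integrableOn_compact hKb.isCompact_closure).mono_set subset_closure
  have hpos : 0 < ∫ x in K, exp (-(V x + W x)) * exp (W x) := by
    simp_rw [eρ]; exact integral_exp_pos hZ
  have key := integral_mul_exp_le_exp_tiltedMean (volume.restrict K) (fun x => (exp_pos _).le) hρi hZ' hgi hpos
  simp_rw [eρ] at key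
  have htilt : (∫ x in K, W x * exp (-V x)) / (∫ x in K, exp (-V x)) =
      ∫ x, W x ∂((volume.restrict K).tilted fun x => -V x) := by
    rw [integral_tilted, ← integral_div]
    refine integral_congr_ae (ae_of_all _ fun x => ?_)
    simp only [smul_eq_mul]
    ring
  rw [htilt] at key
  exact key

/-! ## §2 The windowed tilted mean of `W` under a one-sided quadratic growth letter -/

/-- **THE WINDOWED TILTED SECOND MOMENT ABOUT A CENTRE CARRYING THE VARIATIONAL LETTER**: `K` convex, bounded, measurable, of
positive volume, `x₀ ∈ K`; `V ∈ C¹`, `λ`-uniformly convex ON `K`, `0 ≤ ⟪∇V x₀, y − x₀⟫` on `K`: `∫‖y − x₀‖² dν_{V,K} ≤ n∕λ` —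
`…ConvexWindowVirial.setIntegral_norm_sub_sq_mul_exp_neg_le` divided by the window's mass. [folklore] -/
theorem integral_norm_sub_sq_windowTilted_le {V : EuclideanSpace ℝ (Fin n) → ℝ} {lam : ℝ} {K : Set (EuclideanSpace ℝ (Fin n))}
    (hlam : 0 < lam) (hK : Convex ℝ K) (hKm : MeasurableSet K) (hKb : Bornology.IsBounded K) (hK0 : volume K ≠ 0)
    {x₀ : EuclideanSpace ℝ (Fin n)} (hx₀ : x₀ ∈ K) (hV1 : ContDiff ℝ 1 V)
    (hV : ∀ x ∈ K, ∀ y ∈ K, V x + ⟪gradient V x, y - x⟫ + lam / 2 * ‖y - x‖ ^ 2 ≤ V y)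
    (hvi : ∀ y ∈ K, 0 ≤ ⟪gradient V x₀, y - x₀⟫) :
    ∫ y, ‖y - x₀‖ ^ 2 ∂((volume.restrict K).tilted fun x => -V x) ≤ n / lam := by
  haveI : NeZero (volume.restrict K : Measure (EuclideanSpace ℝ (Fin n))) :=
    ⟨fun h => hK0 (Measure.restrict_eq_zero.1 h)⟩
  have hZ : IntegrableOn (fun x => exp (-V x)) K := integrableOn_exp_neg_of_isBounded hKb hV1.continuous
  have hZpos : 0 < ∫ x in K, exp (-V x) := integral_exp_pos hZ
  have T : ∫ y, ‖y - x₀‖ ^ 2 ∂((volume.restrict K).tilted fun x => -V x) =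
      (∫ y in K, ‖y - x₀‖ ^ 2 * exp (-V y)) / ∫ x in K, exp (-V x) := by
    rw [integral_tilted, ← integral_div]
    congr 1; ext y; rw [smul_eq_mul]; ring
  rw [T, div_le_div_iff₀ hZpos hlam]
  have h := setIntegral_norm_sub_sq_mul_exp_neg_le hK hKm hKb hx₀ hV1 hV hvi
  linarith

/-- **THE WINDOWED TILTED MEAN UNDER A GROWTH LETTER, CENTRE CARRYING THE VARIATIONAL LETTER.**  `K` convex, bounded, measurable, of
positive volume, `x₀ ∈ K`; `V ∈ C¹`, `λ`-uniformly convex ON `K`, `0 ≤ ⟪∇V x₀, y − x₀⟫` on `K`; `W` continuous with `W y ≤ a + b‖y − x₀‖²`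
for `y ∈ K`, `b ≥ 0`.  Then `∫ W dν_{V,K} ≤ a + b·n∕λ`. [folklore] -/
theorem windowTiltedMean_le_of_growth {V W : EuclideanSpace ℝ (Fin n) → ℝ} {lam a b : ℝ} {K : Set (EuclideanSpace ℝ (Fin n))}
    (hlam : 0 < lam) (hK : Convex ℝ K) (hKm : MeasurableSet K) (hKb : Bornology.IsBounded K) (hK0 : volume K ≠ 0)
    {x₀ : EuclideanSpace ℝ (Fin n)} (hx₀ : x₀ ∈ K) (hV1 : ContDiff ℝ 1 V)
    (hV : ∀ x ∈ K, ∀ y ∈ K, V x + ⟪gradient V x, y - x⟫ + lam / 2 * ‖y - x‖ ^ 2 ≤ V y)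
    (hvi : ∀ y ∈ K, 0 ≤ ⟪gradient V x₀, y - x₀⟫) (hWc : Continuous W) (hb : 0 ≤ b)
    (hW : ∀ y ∈ K, W y ≤ a + b * ‖y - x₀‖ ^ 2) :
    ∫ y, W y ∂((volume.restrict K).tilted fun x => -V x) ≤ a + b * (n / lam) := by
  set ν : Measure (EuclideanSpace ℝ (Fin n)) := (volume.restrict K).tilted fun x => -V x with hν
  haveI : NeZero (volume.restrict K : Measure (EuclideanSpace ℝ (Fin n))) :=
    ⟨fun h => hK0 (Measure.restrict_eq_zero.1 h)⟩
  haveI : IsProbabilityMeasure ν := isProbabilityMeasure_tilted (integrableOn_exp_neg_of_isBounded hKb hV1.continuous)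
  have hWi : Integrable W ν := integrable_windowTilted_of_isBounded hKb hV1.continuous hWc
  have h2 : Integrable (fun y : EuclideanSpace ℝ (Fin n) => ‖y - x₀‖ ^ 2) ν :=
    integrable_windowTilted_of_isBounded hKb hV1.continuous ((continuous_id.sub continuous_const).norm.pow 2)
  have hmono : ∫ y, W y ∂ν ≤ ∫ y, (a + b * ‖y - x₀‖ ^ 2) ∂ν := by
    refine integral_mono_ae hWi ((integrable_const a).add (h2.const_mul b)) ?_
    filter_upwards [ae_mem_windowTilted (V := V) hKm] with y hy using hW y hy
  rw [integral_add (integrable_const a) (h2.const_mul b), integral_const, smul_eq_mul, probReal_univ, one_mul,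
    integral_const_mul] at hmono
  have hvir := integral_norm_sub_sq_windowTilted_le hlam hK hKm hKb hK0 hx₀ hV1 hV hvi
  have := mul_le_mul_of_nonneg_left hvir hb
  linarith

/-- **THE WINDOWED TILTED MEAN UNDER A GROWTH LETTER, NO CENTRE LETTER.**  `K` convex, bounded, measurable, of positive volume;
`x₀ ∈ K` (ANY point — e.g. print's expansion point); `V ∈ C¹`, `λ`-uniformly convex ON `K`; `W` continuous with `W y ≤ a + b‖y − x₀‖²`
on `K`, `b ≥ 0`.  Then `∫ W dν_{V,K} ≤ a + b·(‖∇V x₀‖∕λ + √(n∕λ))²` — leaf-01's `hcrit`-free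
`sqrt_integral_norm_sub_sq_windowTilted_le_of_gradient`, squared. [folklore] -/
theorem windowTiltedMean_le_of_growth_of_gradient {V W : EuclideanSpace ℝ (Fin n) → ℝ} {lam a b : ℝ}
    {K : Set (EuclideanSpace ℝ (Fin n))} (hlam : 0 < lam) (hK : Convex ℝ K) (hKm : MeasurableSet K)
    (hKb : Bornology.IsBounded K) (hK0 : volume K ≠ 0) {x₀ : EuclideanSpace ℝ (Fin n)} (hx₀ : x₀ ∈ K) (hV1 : ContDiff ℝ 1 V)
    (hV : ∀ x ∈ K, ∀ y ∈ K, V x + ⟪gradient V x, y - x⟫ + lam / 2 * ‖y - x‖ ^ 2 ≤ V y)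
    (hWc : Continuous W) (hb : 0 ≤ b) (hW : ∀ y ∈ K, W y ≤ a + b * ‖y - x₀‖ ^ 2) :
    ∫ y, W y ∂((volume.restrict K).tilted fun x => -V x) ≤ a + b * (‖gradient V x₀‖ / lam + Real.sqrt (n / lam)) ^ 2 := by
  set ν : Measure (EuclideanSpace ℝ (Fin n)) := (volume.restrict K).tilted fun x => -V x with hν
  haveI : NeZero (volume.restrict K : Measure (EuclideanSpace ℝ (Fin n))) :=
    ⟨fun h => hK0 (Measure.restrict_eq_zero.1 h)⟩
  haveI : IsProbabilityMeasure ν := isProbabilityMeasure_tilted (integrableOn_exp_neg_of_isBounded hKb hV1.continuous)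
  have hWi : Integrable W ν := integrable_windowTilted_of_isBounded hKb hV1.continuous hWc
  have h2 : Integrable (fun y : EuclideanSpace ℝ (Fin n) => ‖y - x₀‖ ^ 2) ν :=
    integrable_windowTilted_of_isBounded hKb hV1.continuous ((continuous_id.sub continuous_const).norm.pow 2)
  have hmono : ∫ y, W y ∂ν ≤ ∫ y, (a + b * ‖y - x₀‖ ^ 2) ∂ν := by
    refine integral_mono_ae hWi ((integrable_const a).add (h2.const_mul b)) ?_
    filter_upwards [ae_mem_windowTilted (V := V) hKm] with y hy using hW y hy
  rw [integral_add (integrable_const a) (h2.const_mul b), integral_const, smul_eq_mul, probReal_univ, one_mul,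
    integral_const_mul] at hmono
  have hM0 : 0 ≤ ∫ y, ‖y - x₀‖ ^ 2 ∂ν := integral_nonneg fun _ => sq_nonneg _
  have hsqrt := sqrt_integral_norm_sub_sq_windowTilted_le_of_gradient hlam hK hKm hKb hK0 hx₀ hV1 hV
  have hs0 : 0 ≤ Real.sqrt (∫ y, ‖y - x₀‖ ^ 2 ∂ν) := Real.sqrt_nonneg _
  have hpow := pow_le_pow_left₀ hs0 hsqrt 2
  rw [Real.sq_sqrt hM0] at hpow
  have := mul_le_mul_of_nonneg_left hpow hb
  linarith

/-! ## §3 The ENDs and the carrier -/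

/-- **THE WINDOWED EXPONENT SHIFT, CENTRE CARRYING THE VARIATIONAL LETTER.**  `K` convex, bounded, measurable, `x₀ ∈ K`; `V ∈ C¹`,
`λ`-uniformly convex ON `K`, `0 ≤ ⟪∇V x₀, y − x₀⟫` on `K`; `W` continuous, `W ≤ a + b‖· − x₀‖²` on `K`, `b ≥ 0`.  Then
`∫_K e^{−V} ≤ exp(a + b·n∕λ) · ∫_K e^{−(V+W)}`. [folklore] -/
theorem exp_shift_le_of_growth_on_boundedConvexWindow {V W : EuclideanSpace ℝ (Fin n) → ℝ} {lam a b : ℝ}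
    {K : Set (EuclideanSpace ℝ (Fin n))} (hlam : 0 < lam) (hK : Convex ℝ K) (hKm : MeasurableSet K)
    (hKb : Bornology.IsBounded K) {x₀ : EuclideanSpace ℝ (Fin n)} (hx₀ : x₀ ∈ K) (hV1 : ContDiff ℝ 1 V)
    (hV : ∀ x ∈ K, ∀ y ∈ K, V x + ⟪gradient V x, y - x⟫ + lam / 2 * ‖y - x‖ ^ 2 ≤ V y)
    (hvi : ∀ y ∈ K, 0 ≤ ⟪gradient V x₀, y - x₀⟫) (hWc : Continuous W) (hb : 0 ≤ b)
    (hW : ∀ y ∈ K, W y ≤ a + b * ‖y - x₀‖ ^ 2) :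
    ∫ x in K, exp (-V x) ≤ exp (a + b * (n / lam)) * ∫ x in K, exp (-(V x + W x)) := by
  by_cases hK0 : volume K = 0
  · have h0 : (volume.restrict K : Measure (EuclideanSpace ℝ (Fin n))) = 0 := Measure.restrict_eq_zero.2 hK0
    rw [h0, integral_zero_measure, integral_zero_measure, mul_zero]
  exact (setIntegral_exp_neg_le_exp_windowTiltedMean_mul hKb hV1.continuous hWc).trans
    (mul_le_mul_of_nonneg_right
      (exp_le_exp.2 (windowTiltedMean_le_of_growth hlam hK hKm hKb hK0 hx₀ hV1 hV hvi hWc hb hW))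
      (integral_nonneg fun _ => (exp_pos _).le))

/-- **THE WINDOWED EXPONENT SHIFT WITHOUT A CENTRE LETTER.**  `K` convex, bounded, measurable; `x₀ ∈ K`; `V ∈ C¹`, `λ`-uniformly
convex ON `K`; `W` continuous with `W ≤ a + b‖· − x₀‖²` on `K`, `b ≥ 0`.  Then
`∫_K e^{−V} ≤ exp(a + b·(‖∇V x₀‖∕λ + √(n∕λ))²) · ∫_K e^{−(V+W)}` — the centre's gradient DISPLAYED, not asked to vanish. [folklore] -/
theorem exp_shift_le_of_growth_on_boundedConvexWindow_of_gradient {V W : EuclideanSpace ℝ (Fin n) → ℝ} {lam a b : ℝ}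
    {K : Set (EuclideanSpace ℝ (Fin n))} (hlam : 0 < lam) (hK : Convex ℝ K) (hKm : MeasurableSet K)
    (hKb : Bornology.IsBounded K) {x₀ : EuclideanSpace ℝ (Fin n)} (hx₀ : x₀ ∈ K) (hV1 : ContDiff ℝ 1 V)
    (hV : ∀ x ∈ K, ∀ y ∈ K, V x + ⟪gradient V x, y - x⟫ + lam / 2 * ‖y - x‖ ^ 2 ≤ V y)
    (hWc : Continuous W) (hb : 0 ≤ b) (hW : ∀ y ∈ K, W y ≤ a + b * ‖y - x₀‖ ^ 2) :
    ∫ x in K, exp (-V x) ≤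
      exp (a + b * (‖gradient V x₀‖ / lam + Real.sqrt (n / lam)) ^ 2) * ∫ x in K, exp (-(V x + W x)) := by
  by_cases hK0 : volume K = 0
  · have h0m : (volume.restrict K : Measure (EuclideanSpace ℝ (Fin n))) = 0 := Measure.restrict_eq_zero.2 hK0
    rw [h0m, integral_zero_measure, integral_zero_measure, mul_zero]
  exact (setIntegral_exp_neg_le_exp_windowTiltedMean_mul hKb hV1.continuous hWc).trans
    (mul_le_mul_of_nonneg_right
      (exp_le_exp.2 (windowTiltedMean_le_of_growth_of_gradient hlam hK hKm hKb hK0 hx₀ hV1 hV hWc hb hW))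
      (integral_nonneg fun _ => (exp_pos _).le))

/-- The exponent-shift carrier `∫_K e^{−V} ∕ ∫_K e^{−(V+W)}` is at most `exp(a + b·(G₀∕λ + √(n∕λ))²)` once `‖∇V x₀‖ ≤ G₀`
(`K` convex bounded measurable, `x₀ ∈ K`, `V ∈ C¹` `λ`-convex on `K`, `W ≤ a + b‖· − x₀‖²` on `K`, `b ≥ 0`). [folklore] -/
theorem exponentShiftCarrier_le {V W : EuclideanSpace ℝ (Fin n) → ℝ} {lam a b G₀ : ℝ} {K : Set (EuclideanSpace ℝ (Fin n))}
    (hlam : 0 < lam) (hK : Convex ℝ K) (hKm : MeasurableSet K) (hKb : Bornology.IsBounded K)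
    {x₀ : EuclideanSpace ℝ (Fin n)} (hx₀ : x₀ ∈ K) (hV1 : ContDiff ℝ 1 V)
    (hV : ∀ x ∈ K, ∀ y ∈ K, V x + ⟪gradient V x, y - x⟫ + lam / 2 * ‖y - x‖ ^ 2 ≤ V y) (hG : ‖gradient V x₀‖ ≤ G₀)
    (hWc : Continuous W) (hb : 0 ≤ b) (hW : ∀ y ∈ K, W y ≤ a + b * ‖y - x₀‖ ^ 2) :
    (∫ x in K, exp (-V x)) / (∫ x in K, exp (-(V x + W x))) ≤ exp (a + b * (G₀ / lam + Real.sqrt (n / lam)) ^ 2) := by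
  refine div_le_of_le_mul₀ (integral_nonneg fun _ => (exp_pos _).le) (exp_pos _).le ?_
  refine (exp_shift_le_of_growth_on_boundedConvexWindow_of_gradient hlam hK hKm hKb hx₀ hV1 hV hWc hb hW).trans
    (mul_le_mul_of_nonneg_right (exp_le_exp.2 ?_) (integral_nonneg fun _ => (exp_pos _).le))
  have hs0 : 0 ≤ ‖gradient V x₀‖ / lam + Real.sqrt (n / lam) :=
    add_nonneg (div_nonneg (norm_nonneg _) hlam.le) (Real.sqrt_nonneg _)
  have hs : ‖gradient V x₀‖ / lam + Real.sqrt (n / lam) ≤ G₀ / lam + Real.sqrt (n / lam) :=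
    add_le_add (div_le_div_of_nonneg_right hG hlam.le) le_rfl
  have := mul_le_mul_of_nonneg_left (pow_le_pow_left₀ hs0 hs 2) hb
  linarith

/-! ## §4 The junction: `LocCondStability` BY NAME for a general one-step exponent difference -/

section Junction

variable {Pt : Type} [DecidableEq Pt] {C : ℕ → Type} {𝒢 : (j : ℕ) → GoodClass (C j)}

/-- **LCS FOR THE EXPONENT-SHIFT CARRIER, ON THE SUPPORT — the family-(2) socket for a GENERAL exponent difference.**  At every
pattern prefix `g` of a level `j < K` and background `y` let `M j g y = ∫_{Kw} e^{−V} ∕ ∫_{Kw} e^{−(V+W)}` for the data at `(j, g, y)`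
on `EuclideanSpace ℝ (Fin (n j g))` — window `Kw j g y`, numerator exponent `V j g y`, difference `W j g y`, nominal centre `x0 j g y`
(background-dependent allowed) —; suppose `M j g` is a.e.-strongly measurable and ON THE SUPPORT OF THE TERM: `Kw` convex, bounded,
measurable with `x0 ∈ Kw`; `V ∈ C¹`, `lam j g`-uniformly convex ON `Kw` in the first-order sense, `‖∇V x0‖ ≤ G₀ j g`; `W` continuous with
the one-sided growth letter `W ≤ a j g + b j g·‖· − x0‖²` on `Kw`, `b ≥ 0`; `lam > 0` — the numbers `lam, a, b, G₀` y-UNIFORM, the fibre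
dimension `n j g`.  Then `LocCondStability T S K μ ρ₀ M (fun j g => a j g + b j g·(G₀ j g∕lam j g + √(n j g∕lam j g))²)`, integrability
conjunct included. [folklore] -/
theorem locCondStability_of_exponentShiftCarrier_on_support (T : Tower Pt C 𝒢)
    (Spat : (j : ℕ) → (Fin j → Pt) → Finset Pt) (K : ℕ) [∀ j, MeasurableSpace (C j)] (μ : (j : ℕ) → Measure (C j))
    (ρ₀ : C 0 → ℝ) (M : (j : ℕ) → (Fin j → Pt) → C j → ℝ) (n : (j : ℕ) → (Fin j → Pt) → ℕ)
    (Kw : (j : ℕ) → (g : Fin j → Pt) → C j → Set (EuclideanSpace ℝ (Fin (n j g))))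
    (V W : (j : ℕ) → (g : Fin j → Pt) → C j → EuclideanSpace ℝ (Fin (n j g)) → ℝ)
    (x0 : (j : ℕ) → (g : Fin j → Pt) → C j → EuclideanSpace ℝ (Fin (n j g)))
    (lam a b G₀ : (j : ℕ) → (Fin j → Pt) → ℝ) (hρ : (𝒢 0).Gd ρ₀) (h0 : ∀ x, 0 ≤ ρ₀ x)
    (hM : ∀ j g, j < K → g ∈ admS T Spat j → ∀ y, M j g y =
      (∫ x in Kw j g y, exp (-V j g y x)) / ∫ x in Kw j g y, exp (-(V j g y x + W j g y x)))
    (hMm : ∀ j g, j < K → g ∈ admS T Spat j → AEStronglyMeasurable (M j g) (μ j))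
    (hlam : ∀ j g, j < K → g ∈ admS T Spat j → 0 < lam j g)
    (hKc : ∀ j g, j < K → g ∈ admS T Spat j → ∀ y, T.eterm ρ₀ j g y ≠ 0 → Convex ℝ (Kw j g y))
    (hKm : ∀ j g, j < K → g ∈ admS T Spat j → ∀ y, T.eterm ρ₀ j g y ≠ 0 → MeasurableSet (Kw j g y))
    (hKb : ∀ j g, j < K → g ∈ admS T Spat j → ∀ y, T.eterm ρ₀ j g y ≠ 0 → Bornology.IsBounded (Kw j g y))
    (hx0 : ∀ j g, j < K → g ∈ admS T Spat j → ∀ y, T.eterm ρ₀ j g y ≠ 0 → x0 j g y ∈ Kw j g y)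
    (hV1 : ∀ j g, j < K → g ∈ admS T Spat j → ∀ y, T.eterm ρ₀ j g y ≠ 0 → ContDiff ℝ 1 (V j g y))
    (hV : ∀ j g, j < K → g ∈ admS T Spat j → ∀ y, T.eterm ρ₀ j g y ≠ 0 → ∀ x ∈ Kw j g y, ∀ z ∈ Kw j g y,
      V j g y x + ⟪gradient (V j g y) x, z - x⟫ + lam j g / 2 * ‖z - x‖ ^ 2 ≤ V j g y z)
    (hG : ∀ j g, j < K → g ∈ admS T Spat j → ∀ y, T.eterm ρ₀ j g y ≠ 0 → ‖gradient (V j g y) (x0 j g y)‖ ≤ G₀ j g)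
    (hWc : ∀ j g, j < K → g ∈ admS T Spat j → ∀ y, T.eterm ρ₀ j g y ≠ 0 → Continuous (W j g y))
    (hb : ∀ j g, j < K → g ∈ admS T Spat j → 0 ≤ b j g)
    (hW : ∀ j g, j < K → g ∈ admS T Spat j → ∀ y, T.eterm ρ₀ j g y ≠ 0 →
      ∀ x ∈ Kw j g y, W j g y x ≤ a j g + b j g * ‖x - x0 j g y‖ ^ 2)
    (hint : ∀ j g, j < K → g ∈ admS T Spat j → Integrable (T.eterm ρ₀ j g) (μ j)) :
    LocCondStability T Spat K μ ρ₀ M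
      (fun j g => a j g + b j g * (G₀ j g / lam j g + Real.sqrt (n j g / lam j g)) ^ 2) := by
  refine locCondStability_of_carrier_le_on_support T Spat K μ ρ₀ M _ hρ h0 hMm (fun j g hj hg y => ?_)
    (fun j g hj hg y hy => ?_) hint
  · rw [hM j g hj hg y]
    exact div_nonneg (integral_nonneg fun _ => (exp_pos _).le) (integral_nonneg fun _ => (exp_pos _).le)
  · rw [hM j g hj hg y]
    exact exponentShiftCarrier_le (hlam j g hj hg) (hKc j g hj hg y hy) (hKm j g hj hg y hy) (hKb j g hj hg y hy)
      (hx0 j g hj hg y hy) (hV1 j g hj hg y hy) (hV j g hj hg y hy) (hG j g hj hg y hy) (hWc j g hj hg y hy) (hb j g hj hg)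
      (hW j g hj hg y hy)

end Junction

end Summit.QuantumFields.BalabanUV.T4Continuum.NE7b.ConvexWindowExponentShift

end
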